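import Summits.SmoothPoincare4.SmoothPoincare4.Theorems.CylinderEntropySliceIsolationStubSeparationPersistsAux2
import Mathlib.Geometry.Manifold.Metrizable
import HarnessLib

/-!
# End-separation persists along a cylinder flow, part 3: geometry of the cylinder; points near a cross-section are push-offs

Part of the proof of the stub `stub_separationPersists` (END-SEPARATION PERSISTS ALONG A CYLINDER
FLOW) of line `conformal-kernel-domination` (closing chain γ) of the crux `CylinderEntropy.SliceIsolation`
(stmt-SmoothPoincare4-7632); see `CylinderEntropySliceIsolationStubSeparationPersists.lean` for the
overall argument. Everything here is proved (no named facts, no definitions: the tube chart is passed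
as a function `Ψ` with the hypothesis `hΨ` spelling it out, instantiated by `rfl`).

* elementary geometry of `N = S⁴ × ℝ`: the radial normalisation moves a point by `|1 - ‖z'‖|`
  (`norm_nrm_sub_self`), short normalised segments join nearby points of `N` near where they are
  (`joinedIn_nrm_segment`), `N` is connected (`isPreconnected_cylN`);
* `exists_pushoff_of_infDist_lt` — every point of `N` within `δ` of the compact cross-section
  `ι(M)` is a normalised push-off `nrm(ι x + r ν x)` with `|r| < ε` (part 2 at a nearest point, and
  compactness of `M`);
* `joinedIn_pushoffs_of_notMem` — the push-offs of one sign are mutually joined off `ι(M)`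
  (`M × (0, t₀]` is path connected).

## References

* M. W. Hirsch, *Differential Topology*, GTM 33 (1976), Ch. 4 §5 (tubular neighbourhoods), Ch. 8
  Thm. 1.3 (isotopy extension). [HirschDT1976]
* A. Hatcher, *Algebraic Topology*, CUP (2002), Prop. 3.46 (Jordan–Brouwer separation via Alexander
  duality). [HatcherAT2002]
-/

set_option linter.dupNamespace false

noncomputable section

open MeasureTheory Set Function Filter Module Asymptotics Metric
open scoped Manifold ContDiff ENNReal Topology RealInnerProductSpace NNReal

namespace Summit.SmoothPoincare4.SmoothPoincare4.Theorems.CylinderEntropySliceIsolation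

open Summit.SmoothPoincare4.SmoothPoincare4.Theorems.CylinderRungTwo.KillingFlux
open Literature.Geometry.Riemannian
open Literature.Geometry.Lorentzian Literature.Geometry.Lorentzian.PseudoRiemannianMetric
open Literature.Geometry.Riemannian.SphericalCylinderEntropy (truncL truncL_apply lipschitz_truncL
  norm_truncL_le)
open Literature.Geometry.Manifold.CylinderSlice (axis castSucc_ne_five padL padL_apply_castSucc
  padL_apply_last)

/-! ## §1 Elementary geometry of `N`: short normalised segments, connectedness -/

section Cylinder

/-- The normalisation moves a point off the axis by `|1 - ‖z'‖|`. [folklore] -/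
theorem norm_nrm_sub_self {z : EuclideanSpace ℝ (Fin 6)} (hz : truncL z ≠ 0) :
    ‖(fun z : EuclideanSpace ℝ (Fin 6) => (‖truncL z‖⁻¹ : ℝ) • (z - z (5 : Fin 6) •
      (axis : EuclideanSpace ℝ (Fin 6))) + z (5 : Fin 6) • (axis : EuclideanSpace ℝ (Fin 6))) z - z‖ =
      |1 - ‖truncL z‖| := by
  set ρ : ℝ := ‖truncL z‖ with hρ
  have hρ0 : 0 < ρ := norm_pos_iff.2 hz
  set q : EuclideanSpace ℝ (Fin 6) := z - z 5 • (axis : EuclideanSpace ℝ (Fin 6)) with hq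
  have hq_norm : ‖q‖ = ρ := by
    have h2 : ‖q‖ ^ 2 = ρ ^ 2 := by
      rw [hρ, norm_truncL_sq, EuclideanSpace.norm_sq_eq,
        Fin.sum_univ_castSucc (f := fun i : Fin 6 => ‖q i‖ ^ 2)]
      simp [hq, axis, castSucc_ne_five, Real.norm_eq_abs, sq_abs]
    exact (pow_left_inj₀ (norm_nonneg _) hρ0.le two_ne_zero).1 h2
  have hdiff : (fun z : EuclideanSpace ℝ (Fin 6) => (‖truncL z‖⁻¹ : ℝ) • (z - z (5 : Fin 6) •
      (axis : EuclideanSpace ℝ (Fin 6))) + z (5 : Fin 6) • (axis : EuclideanSpace ℝ (Fin 6))) z - z =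
      (ρ⁻¹ - 1) • q := by
    show (ρ⁻¹ • q + z 5 • (axis : EuclideanSpace ℝ (Fin 6))) - z = (ρ⁻¹ - 1) • q
    have : z = q + z 5 • (axis : EuclideanSpace ℝ (Fin 6)) := by rw [hq, sub_add_cancel]
    conv_lhs => rw [this]
    simp only [sub_smul, one_smul]
    abel_nf
    simp [hq]
  rw [hdiff, norm_smul, hq_norm, Real.norm_eq_abs]
  have : (ρ⁻¹ - 1) * ρ = 1 - ρ := by field_simp
  calc |ρ⁻¹ - 1| * ρ = |ρ⁻¹ - 1| * |ρ| := by rw [abs_of_pos hρ0]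
    _ = |(ρ⁻¹ - 1) * ρ| := (abs_mul _ _).symm
    _ = |1 - ρ| := by rw [this]

/-- `‖z'‖ = 1` on `N` (private copy of the tree's
`CylinderEntropySliceIsolationConformalMapLipschitz.norm_truncL_eq_one`, renamed and kept local to avoid importing
all of Mathlib through that module). [folklore] -/
private theorem norm_truncL_eq_one_of_mem_cyl {z : EuclideanSpace ℝ (Fin 6)} (hz : ∑ i : Fin 5, z (Fin.castSucc i) ^ 2 = 1) :
    ‖truncL z‖ = 1 := by
  rw [← Real.sqrt_sq (norm_nonneg _), norm_truncL_sq, hz, Real.sqrt_one]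

/-- **Short normalised segments.** Two points `w, w'` of `N` with `‖w' - w‖ < 1/2` are joined,
inside `N` and within distance `2‖w' - w‖` of `w`, by the radial normalisation of the straight
segment between them. [folklore] -/
theorem joinedIn_nrm_segment {w w' : EuclideanSpace ℝ (Fin 6)}
    (hw : ∑ i : Fin 5, w (Fin.castSucc i) ^ 2 = 1) (hw' : ∑ i : Fin 5, w' (Fin.castSucc i) ^ 2 = 1)
    (hd : ‖w' - w‖ < 1 / 2) :
    JoinedIn {z : EuclideanSpace ℝ (Fin 6) | ∑ i : Fin 5, z (Fin.castSucc i) ^ 2 = 1 ∧ ‖z - w‖ ≤ 2 * ‖w' - w‖} w w' := by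
  -- the straight segment and its distance to `w`
  set seg : ℝ → EuclideanSpace ℝ (Fin 6) := fun s => w + s • (w' - w) with hseg
  have hsegc : Continuous seg := by rw [hseg]; fun_prop
  have hsegd : ∀ s ∈ Icc (0 : ℝ) 1, ‖seg s - w‖ ≤ ‖w' - w‖ := fun s hs => by
    rw [hseg]
    simp only [add_sub_cancel_left, norm_smul, Real.norm_eq_abs, abs_of_nonneg hs.1]
    nlinarith [norm_nonneg (w' - w), hs.2]
  have htr : ∀ s ∈ Icc (0 : ℝ) 1, 1 - ‖w' - w‖ ≤ ‖truncL (seg s)‖ ∧ ‖truncL (seg s)‖ ≤ 1 + ‖w' - w‖ := by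
    intro s hs
    have h1 : ‖truncL (seg s) - truncL w‖ ≤ ‖seg s - w‖ := by
      rw [← map_sub]
      exact norm_truncL_le _
    have h2 := norm_truncL_eq_one_of_mem_cyl hw
    constructor
    · have := norm_sub_norm_le (truncL w) (truncL (seg s))
      rw [norm_sub_rev] at h1
      linarith [hsegd s hs]
    · have := norm_le_insert' (truncL (seg s)) (truncL w)
      linarith [hsegd s hs]
  have htr0 : ∀ s ∈ Icc (0 : ℝ) 1, truncL (seg s) ≠ 0 := fun s hs h => by
    have := (htr s hs).1
    rw [h, norm_zero] at this
    linarith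
  -- the normalised segment
  set F : ℝ → EuclideanSpace ℝ (Fin 6) := fun s => (fun z : EuclideanSpace ℝ (Fin 6) => (‖truncL z‖⁻¹ : ℝ) •
      (z - z (5 : Fin 6) • (axis : EuclideanSpace ℝ (Fin 6))) + z (5 : Fin 6) • (axis : EuclideanSpace ℝ (Fin 6)))
      (seg s) with hF
  have hFc : ContinuousOn F (Icc (0 : ℝ) 1) :=
    continuousOn_nrm.comp hsegc.continuousOn fun s hs => htr0 s hs
  have h0 : F 0 = w := by
    have : seg 0 = w := by simp [hseg]
    simp only [hF, this]
    exact nrm_eq_self hw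
  have h1 : F 1 = w' := by
    have : seg 1 = w' := by simp [hseg]
    simp only [hF, this]
    exact nrm_eq_self hw'
  refine JoinedIn.ofLine hFc h0 h1 ?_
  rintro _ ⟨s, hs, rfl⟩
  refine ⟨sum_sq_nrm (htr0 s hs), ?_⟩
  have hmove : ‖F s - seg s‖ ≤ ‖w' - w‖ := by
    rw [hF, norm_nrm_sub_self (htr0 s hs), abs_le]
    constructor <;> linarith [(htr s hs).1, (htr s hs).2]
  calc ‖F s - w‖ = ‖(F s - seg s) + (seg s - w)‖ := by rw [sub_add_sub_cancel]
    _ ≤ ‖F s - seg s‖ + ‖seg s - w‖ := norm_add_le _ _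
    _ ≤ ‖w' - w‖ + ‖w' - w‖ := add_le_add hmove (hsegd s hs)
    _ = 2 * ‖w' - w‖ := by ring

/-- Points of the unit sphere of `ℝ⁵` satisfy `∑ pᵢ² = 1`. [folklore] -/
theorem sum_sq_of_norm_eq_one {p : EuclideanSpace ℝ (Fin 5)} (hp : ‖p‖ = 1) : ∑ i : Fin 5, p i ^ 2 = 1 := by
  have h := EuclideanSpace.norm_sq_eq p
  rw [hp, one_pow] at h
  simpa [Real.norm_eq_abs, sq_abs] using h.symm

/-- **The cylinder `N = S⁴ × ℝ` is connected** (continuous image of `S⁴ × ℝ`). [folklore] -/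
theorem isPreconnected_cylN :
    IsPreconnected ({z : EuclideanSpace ℝ (Fin 6) | ∑ i : Fin 5, z (Fin.castSucc i) ^ 2 = 1} :
      Set (EuclideanSpace ℝ (Fin 6))) := by
  have hS : IsConnected (Metric.sphere (0 : EuclideanSpace ℝ (Fin 5)) 1 ×ˢ (univ : Set ℝ)) := by
    refine IsConnected.prod ?_ isConnected_univ
    refine isConnected_sphere ?_ 0 zero_le_one
    rw [← Module.finrank_eq_rank, finrank_euclideanSpace_fin]
    exact_mod_cast (by norm_num : (1 : ℕ) < 5)
  have hf : Continuous fun q : EuclideanSpace ℝ (Fin 5) × ℝ => padL q.1 + q.2 • (axis : EuclideanSpace ℝ (Fin 6)) := by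
    fun_prop
  have himg : (fun q : EuclideanSpace ℝ (Fin 5) × ℝ => padL q.1 + q.2 • (axis : EuclideanSpace ℝ (Fin 6))) ''
      (Metric.sphere (0 : EuclideanSpace ℝ (Fin 5)) 1 ×ˢ (univ : Set ℝ)) =
      ({z : EuclideanSpace ℝ (Fin 6) | ∑ i : Fin 5, z (Fin.castSucc i) ^ 2 = 1} : Set (EuclideanSpace ℝ (Fin 6))) := by
    ext z
    constructor
    · rintro ⟨⟨p, h⟩, ⟨hp, -⟩, rfl⟩
      exact vert_mem_Ncyl (sum_sq_of_norm_eq_one (by simpa using hp)) h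
    · intro hz
      refine ⟨(truncL z, z 5), ⟨?_, mem_univ _⟩, (eq_vert z).symm⟩
      simpa using norm_truncL_eq_one_of_mem_cyl hz
  rw [← himg]
  exact (hS.image _ hf.continuousOn).isPreconnected

end Cylinder

/-! ## §2 Points near the cross-section are push-offs; the two families of push-offs -/

section Sides

variable {M : Type} [TopologicalSpace M] [ChartedSpace (EuclideanSpace ℝ (Fin 4)) M]
  [IsManifold (𝓡 4) ∞ M]

variable {ι ν : M → EuclideanSpace ℝ (Fin 6)}

/-- **Points of `N` close to `ι(M)` are normalised push-offs** `nrm(ι x + r ν x)` with `|r| < ε`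
(the local statement `exists_ball_subset_pushoff` at a nearest point, and compactness of `M`).
[folklore] -/
theorem exists_pushoff_of_infDist_lt [T2Space M] [CompactSpace M] [Nonempty M]
    (hι : Manifold.IsSmoothEmbedding (𝓡 4) (𝓡 6) ∞ ι)
    (hιN : ∀ x, ∑ i : Fin 5, ι x (Fin.castSucc i) ^ 2 = 1) (hνs : ContMDiff (𝓡 4) (𝓡 6) ∞ ν)
    (hνn : (euclideanMetric (EuclideanSpace ℝ (Fin 6))).IsUnitNormal (𝓡 4) ι ν 1)
    (hνt : ∀ x, ∑ i : Fin 5, ν x (Fin.castSucc i) * ι x (Fin.castSucc i) = 0) {ε : ℝ} (hε : 0 < ε) :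
    ∃ δ : ℝ, 0 < δ ∧ ∀ z : EuclideanSpace ℝ (Fin 6), ∑ i : Fin 5, z (Fin.castSucc i) ^ 2 = 1 →
      infDist z (range ι) < δ → ∃ x : M, ∃ r : ℝ, |r| < ε ∧
        z = (fun z : EuclideanSpace ℝ (Fin 6) => (‖truncL z‖⁻¹ : ℝ) • (z - z (5 : Fin 6) •
          (axis : EuclideanSpace ℝ (Fin 6))) + z (5 : Fin 6) • (axis : EuclideanSpace ℝ (Fin 6))) (ι x + r • ν x) := by
  haveI : TopologicalSpace.MetrizableSpace M := Manifold.metrizableSpace (𝓡 4) M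
  have hιc : Continuous ι := hι.contMDiff.continuous
  by_contra H
  push Not at H
  -- a bad sequence `zₙ ∈ N`, `infDist zₙ (ι M) < 1/(n+1)`, not a push-off with `|r| < ε`
  have hbad : ∀ n : ℕ, ∃ z : EuclideanSpace ℝ (Fin 6), ∑ i : Fin 5, z (Fin.castSucc i) ^ 2 = 1 ∧
      infDist z (range ι) < 1 / ((n : ℝ) + 1) ∧ ∀ x : M, ∀ r : ℝ, |r| < ε →
        z ≠ (fun z : EuclideanSpace ℝ (Fin 6) => (‖truncL z‖⁻¹ : ℝ) • (z - z (5 : Fin 6) •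
          (axis : EuclideanSpace ℝ (Fin 6))) + z (5 : Fin 6) • (axis : EuclideanSpace ℝ (Fin 6))) (ι x + r • ν x) :=
    fun n => H _ (by positivity)
  choose z hzN hzd hzne using hbad
  -- nearest points `ι yₙ`
  have hnear : ∀ n : ℕ, ∃ y : M, dist (z n) (ι y) < 1 / ((n : ℝ) + 1) := fun n => by
    obtain ⟨_, ⟨y, rfl⟩, hy⟩ := (infDist_lt_iff (range_nonempty ι)).1 (hzd n)
    exact ⟨y, hy⟩
  choose y hy using hnear
  obtain ⟨x₀, -, φ, hφ, hyφ⟩ := isCompact_univ.tendsto_subseq (x := y) fun n => mem_univ _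
  -- `z (φ n) → ι x₀`
  have hdist0 : Tendsto (fun n => dist (z (φ n)) (ι (y (φ n)))) atTop (𝓝 0) := by
    refine tendsto_of_tendsto_of_tendsto_of_le_of_le tendsto_const_nhds
      (tendsto_one_div_add_atTop_nhds_zero_nat.comp hφ.tendsto_atTop) (fun n => dist_nonneg) fun n => ?_
    exact (hy (φ n)).le
  have hzlim : Tendsto (fun n => z (φ n)) atTop (𝓝 (ι x₀)) := by
    have h1 : Tendsto (fun n => ι (y (φ n))) atTop (𝓝 (ι x₀)) := (hιc.tendsto x₀).comp hyφ
    rw [tendsto_iff_dist_tendsto_zero] at h1 ⊢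
    refine tendsto_of_tendsto_of_tendsto_of_le_of_le tendsto_const_nhds (hdist0.add h1 |>.congr' ?_ |>.trans ?_)
      (fun n => dist_nonneg) fun n => dist_triangle _ (ι (y (φ n))) _
    · exact Eventually.of_forall fun n => rfl
    · simp
  obtain ⟨δ, hδ, hball⟩ := exists_ball_subset_pushoff hι hιN hνs hνn hνt x₀ rfl hε
  obtain ⟨n, hn⟩ := ((tendsto_iff_norm_sub_tendsto_zero.1 hzlim).eventually (gt_mem_nhds hδ)).exists
  obtain ⟨x, r, hr, hzr⟩ := hball (z (φ n)) (hzN (φ n)) hn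
  exact hzne (φ n) x r hr hzr

omit [IsManifold (𝓡 4) ∞ M] in
/-- **The push-offs of one sign are mutually joined**: for a continuous direction field `τ`
tangent to `N` whose normalised push-offs `nrm(ι x + t τ x)`, `0 < t ≤ t₀`, miss `ι(M)`, any two
of them are joined in `N ∖ ι(M)` (`M × (0, t₀]` is path connected). [folklore] -/
-- adapted from the inner lemma `key` of `exists_side_constants`
-- (Theorems/CylinderEntropyCylinderRungTwoFluxIdentitySides.lean)
theorem joinedIn_pushoffs_of_notMem [T2Space M] [CompactSpace M] [ConnectedSpace M]
    (hι : Manifold.IsSmoothEmbedding (𝓡 4) (𝓡 6) ∞ ι)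
    (hιN : ∀ x, ∑ i : Fin 5, ι x (Fin.castSucc i) ^ 2 = 1) {τ : M → EuclideanSpace ℝ (Fin 6)}
    (hτc : Continuous τ) (hτt : ∀ x, ∑ i : Fin 5, τ x (Fin.castSucc i) * ι x (Fin.castSucc i) = 0)
    {t₀ : ℝ} (ht₀ : 0 < t₀)
    (hτ : ∀ x, ∀ t ∈ Ioc (0 : ℝ) t₀, (fun z : EuclideanSpace ℝ (Fin 6) => (‖truncL z‖⁻¹ : ℝ) • (z - z (5 : Fin 6) •
      (axis : EuclideanSpace ℝ (Fin 6))) + z (5 : Fin 6) • (axis : EuclideanSpace ℝ (Fin 6))) (ι x + t • τ x) ∉ range ι)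
    (x : M) {t : ℝ} (ht : t ∈ Ioc (0 : ℝ) t₀) (x' : M) {t' : ℝ} (ht' : t' ∈ Ioc (0 : ℝ) t₀) :
    JoinedIn (({z : EuclideanSpace ℝ (Fin 6) | ∑ i : Fin 5, z (Fin.castSucc i) ^ 2 = 1} :
        Set (EuclideanSpace ℝ (Fin 6))) \ range ι)
      ((fun z : EuclideanSpace ℝ (Fin 6) => (‖truncL z‖⁻¹ : ℝ) • (z - z (5 : Fin 6) •
        (axis : EuclideanSpace ℝ (Fin 6))) + z (5 : Fin 6) • (axis : EuclideanSpace ℝ (Fin 6))) (ι x + t • τ x))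
      ((fun z : EuclideanSpace ℝ (Fin 6) => (‖truncL z‖⁻¹ : ℝ) • (z - z (5 : Fin 6) •
        (axis : EuclideanSpace ℝ (Fin 6))) + z (5 : Fin 6) • (axis : EuclideanSpace ℝ (Fin 6))) (ι x' + t' • τ x')) := by
  haveI : TopologicalSpace.MetrizableSpace M := Manifold.metrizableSpace (𝓡 4) M
  haveI : LocallyPathConnectedSpace M := ChartedSpace.locallyPathConnectedSpace (EuclideanSpace ℝ (Fin 4)) M
  haveI : PathConnectedSpace M := pathConnectedSpace_iff_connectedSpace.2 inferInstance
  have hιc : Continuous ι := hι.contMDiff.continuous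
  set Ψ : M × ℝ → EuclideanSpace ℝ (Fin 6) := fun q => (fun z : EuclideanSpace ℝ (Fin 6) => (‖truncL z‖⁻¹ : ℝ) •
      (z - z (5 : Fin 6) • (axis : EuclideanSpace ℝ (Fin 6))) + z (5 : Fin 6) • (axis : EuclideanSpace ℝ (Fin 6)))
      (ι q.1 + q.2 • τ q.1) with hΨ
  have hinner : Continuous fun q : M × ℝ => ι q.1 + q.2 • τ q.1 :=
    (hιc.comp continuous_fst).add (continuous_snd.smul (hτc.comp continuous_fst))
  have hΨc : ContinuousOn Ψ (univ ×ˢ Ioc (0 : ℝ) t₀) := by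
    refine continuousOn_nrm.comp hinner.continuousOn fun q _ => ?_
    exact (norm_nrm_sub_le (hιN q.1) (hτt q.1) q.2).1
  have hpc : IsPathConnected (Ψ '' (univ ×ˢ Ioc (0 : ℝ) t₀)) :=
    (isPathConnected_univ.prod ((convex_Ioc (0 : ℝ) t₀).isPathConnected ⟨t₀, ht₀, le_rfl⟩)).image' hΨc
  have hsub : Ψ '' (univ ×ˢ Ioc (0 : ℝ) t₀) ⊆ ({z : EuclideanSpace ℝ (Fin 6) | ∑ i : Fin 5, z (Fin.castSucc i) ^ 2
        = 1} : Set (EuclideanSpace ℝ (Fin 6))) \ range ι := by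
    rintro _ ⟨⟨y, s⟩, ⟨-, hs⟩, rfl⟩
    exact nrm_pushoff_mem hιN (hτt y) (hτ y s hs)
  exact (hpc.joinedIn (Ψ (x, t)) (mem_image_of_mem Ψ ⟨mem_univ _, ht⟩) (Ψ (x', t'))
    (mem_image_of_mem Ψ ⟨mem_univ _, ht'⟩)).mono hsub

end Sides

/-- Marker of this part (registered sub-goal `helper_sepPersistsNormTruncLLe` of stmt-SmoothPoincare4-7632): dropping the last coordinate does not increase the norm (the tree's `SphericalCylinderEntropy.norm_truncL_le`, the Lipschitz control of short normalised segments). [folklore] -/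
theorem helper_sepPersistsNormTruncLLe :
    ∀ v : EuclideanSpace ℝ (Fin 6), ‖Literature.Geometry.Riemannian.SphericalCylinderEntropy.truncL v‖ ≤ ‖v‖ :=
  fun v => norm_truncL_le v

end Summit.SmoothPoincare4.SmoothPoincare4.Theorems.CylinderEntropySliceIsolation
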